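import Literature.NumberTheory.Weil1964.AdelicDoublingDiagonalLift
import Literature.NumberTheory.GelbartRogawski1991.UnitaryDualPairSplittingDatum
import Literature.NumberTheory.Automorphic.UnitaryDualPairDoubledLineDiagonal
import HarnessLib

/-!
# Frames for the doubled `W`-member: the diagonal Lagrangian `V ⊗ W^Δ` in the `Fin (n + n)` enumeration, and
# `P_𝕐`-membership after conjugation by Li's `δ`

Topic `NumberTheory/Automorphic`; namespace `Literature.NumberTheory.Automorphic.UnitaryGroup` (sequel of `UnitaryDualPairDoubledLineDiagonal`;
frames of ★ `Weil1964/AdelicDoublingDiagonalLift`).  KERNEL only: proved theorems, no definition, no named fact.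

* §1 `reindexW_trans`, and for an enumeration `E₁ : Fin N × Fin (1+1) ≃ Fin n ⊕ Fin n` with `E₁ (i, 0) = inl (e (i, 0))`, `E₁ (i, 1) = inr (e (i, 0))`
  (the doubled enumeration of the E-2 child line, before its final `finSumFinEquiv`): **`isDiag_iff_of_frame`** — Weil's diagonal condition
  `IsDiag u` (★ `Weil1964.IsDiag`: the two halves of `u ∈ (W ⊕ W⁻)` agree) is the `W`-coordinate condition `a (i, 0) = a (i, 1)`, `b (i, 0) = b (i, 1)`
  of `UnitaryDualPairDoubledLineDiagonal` on `(u.1 ∘ E₁, u.2 ∘ E₁)`; the frame values `doubledFrame_apply_zero∕one` for the concrete `E₁`;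
* §2 **`conj_doublingDelta_mem_siegelParabolicPi_of_isDiag`** — in the `Fin (n + n)` frame of `𝕋 = doubledGramFin F T`: if `X ∈ Sp(𝕎□_𝔸)` and
  `X⁻¹` map the (re-enumerated) diagonal `W^Δ` into itself then `δ X δ⁻¹ ∈ P_𝕐(𝔸)` (`δ = spReindex finSumFinEquiv _ (doublingDelta T hT)`,
  ★ `doublingDelta_symm_apply_zero`, ★ `doublingDelta_apply_diag`) — the `Fin (n+n)`-frame form of ★ `conj_doublingDelta_mem_siegelParabolicPi`
  («`δ · Stab(W^Δ) · δ⁻¹ ≤ P_𝕐`», [Li1992, p. 181]), stated on vectors so that no transport of `Sp`-types along Gram identities is needed;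
* §3 **`toSp_doubled_rationalInr_isDiag`** — for a rational Siegel `w` (`w₀₀ + w₀₁ = w₁₀ + w₁₁`) of the rank-two `W`-space, the automorphism
  `toSp (E₁.trans finSumFinEquiv) (adelicInr (toAdelic w))` of the doubled dual pair maps the re-enumerated diagonal into itself
  (§1 + ★ `adelicPairToSymplectic_rationalInr_diag`).

Consumer: `stub_SW3_orbit` of `Cruxes/H413/Lines/F0_E2SiegelWeilWeilRange.lean` (cell `pub/hodgecm-mathlib`), seat F0P4-p08, 2026-08-31.

## References

* [Li1992] J.-S. Li, J. reine angew. Math. 428 (1992), p. 181 (`δ`, `δ(W^Δ) = 𝕐`).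
* [GelbartPiatetskishapiroRallis1987] S. Gelbart, I. Piatetski-Shapiro, S. Rallis, LNM 1254 (1987), Part A §2 pp. 7–9.
-/

set_option autoImplicit false

noncomputable section

open scoped Kronecker Matrix
open NumberField
open Literature.RepresentationTheory.HeisenbergGroup
open Literature.NumberTheory.Weil1964

namespace Literature.NumberTheory.Automorphic

namespace UnitaryGroup

/-! ## §1 The diagonal in the doubled enumeration -/

section Frame

variable {K : Type*} {N n : ℕ} (e : Fin N × Fin 1 ≃ Fin n)

/-- the doubled enumeration (before `finSumFinEquiv`) sends `(i, 0)` to `inl (e (i, 0))`. [cite: GelbartPiatetskishapiroRallis1987, Part A §2 pp. 7–9] -/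
theorem doubledFrame_apply_zero (i : Fin N) :
    (((Equiv.prodCongr (Equiv.refl (Fin N)) finSumFinEquiv.symm).trans (Equiv.prodSumDistrib (Fin N) (Fin 1) (Fin 1))).trans
      (Equiv.sumCongr e e)) (i, 0) = Sum.inl (e (i, 0)) := by
  have h0 : (finSumFinEquiv.symm (0 : Fin (1 + 1)) : Fin 1 ⊕ Fin 1) = Sum.inl 0 := by decide
  simp [Equiv.prodSumDistrib, Equiv.sumProdDistrib, Equiv.prodCongr, h0]

/-- the doubled enumeration sends `(i, 1)` to `inr (e (i, 0))`. [cite: GelbartPiatetskishapiroRallis1987, Part A §2 pp. 7–9] -/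
theorem doubledFrame_apply_one (i : Fin N) :
    (((Equiv.prodCongr (Equiv.refl (Fin N)) finSumFinEquiv.symm).trans (Equiv.prodSumDistrib (Fin N) (Fin 1) (Fin 1))).trans
      (Equiv.sumCongr e e)) (i, 1) = Sum.inr (e (i, 0)) := by
  have h1 : (finSumFinEquiv.symm (1 : Fin (1 + 1)) : Fin 1 ⊕ Fin 1) = Sum.inr 0 := by decide
  simp [Equiv.prodSumDistrib, Equiv.sumProdDistrib, Equiv.prodCongr, h1]

/-- **Weil's diagonal condition in the doubled enumeration**: for `E₁ : Fin N × Fin 2 ≃ Fin n ⊕ Fin n` with `E₁ (i, 0) = inl (e (i, 0))`,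
`E₁ (i, 1) = inr (e (i, 0))`, a vector `u` of `(W ⊕ W⁻)` is diagonal (`IsDiag`) iff its pull-back `(u.1 ∘ E₁, u.2 ∘ E₁)` has equal
`W`-coordinates. [cite: GelbartPiatetskishapiroRallis1987, Part A §2 pp. 7–9] -/
theorem isDiag_iff_of_frame {E₁ : Fin N × Fin (1 + 1) ≃ Fin n ⊕ Fin n} (hE0 : ∀ i, E₁ (i, 0) = Sum.inl (e (i, 0)))
    (hE1 : ∀ i, E₁ (i, 1) = Sum.inr (e (i, 0))) (u : (Fin n ⊕ Fin n → K) × (Fin n ⊕ Fin n → K)) :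
    Weil1964.IsDiag u ↔ (∀ i, (u.1 ∘ E₁) (i, 0) = (u.1 ∘ E₁) (i, 1)) ∧ ∀ i, (u.2 ∘ E₁) (i, 0) = (u.2 ∘ E₁) (i, 1) := by
  have hsurj : ∀ k : Fin n, ∃ i : Fin N, e (i, 0) = k := fun k => by
    obtain ⟨⟨i, j⟩, hij⟩ := e.surjective k
    exact ⟨i, by rw [← hij, Subsingleton.elim j 0]⟩
  constructor
  · rintro ⟨h1, h2⟩
    refine ⟨fun i => ?_, fun i => ?_⟩
    · simp only [Function.comp_apply, hE0, hE1]
      exact congrFun h1 (e (i, 0))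
    · simp only [Function.comp_apply, hE0, hE1]
      exact congrFun h2 (e (i, 0))
  · rintro ⟨h1, h2⟩
    refine ⟨funext fun k => ?_, funext fun k => ?_⟩
    · obtain ⟨i, rfl⟩ := hsurj k
      have h := h1 i
      simp only [Function.comp_apply, hE0, hE1] at h
      exact h
    · obtain ⟨i, rfl⟩ := hsurj k
      have h := h2 i
      simp only [Function.comp_apply, hE0, hE1] at h
      exact h

end Frame

/-! ## §2 `P_𝕐`-membership after conjugation by `δ`, from diagonal-stability, in the `Fin (n + n)` frame -/

section Parabolic

variable (F : Type) [Field F] [NumberField F] {n : ℕ}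
  (T : Matrix (Fin n) (Fin n) (AdeleRing (𝓞 F) F)) (hT : IsUnit T.det)

/-- one clause: if `X` maps the re-enumerated diagonal into itself then `(δ X δ⁻¹)(0, y)` has zero `𝕏`-component.
[cite: Li1992, p. 181] -/
theorem conj_doublingDelta_apply_zero_fst_of_isDiag
    (X : symplecticGroup (polar (Weil1964.adelicForm F (Fin (n + n)) (doubledGramFin F T))))
    (hX : ∀ u : (Fin n ⊕ Fin n → AdeleRing (𝓞 F) F) × (Fin n ⊕ Fin n → AdeleRing (𝓞 F) F), Weil1964.IsDiag u →
      Weil1964.IsDiag ((reindexW (AdeleRing (𝓞 F) F) finSumFinEquiv).symm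
        ((X : ((Fin (n + n) → AdeleRing (𝓞 F) F) × (Fin (n + n) → AdeleRing (𝓞 F) F)) ≃ₗ[AdeleRing (𝓞 F) F] ((Fin (n + n) → AdeleRing (𝓞 F) F) × (Fin (n + n) → AdeleRing (𝓞 F) F))) (reindexW (AdeleRing (𝓞 F) F) finSumFinEquiv u))))
    (y : Fin (n + n) → AdeleRing (𝓞 F) F) :
    (((spReindex finSumFinEquiv (Matrix.fromBlocks T 0 0 (-T)) (doublingDelta T hT) * X *
        (spReindex finSumFinEquiv (Matrix.fromBlocks T 0 0 (-T)) (doublingDelta T hT))⁻¹ :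
          symplecticGroup (polar (Weil1964.adelicForm F (Fin (n + n)) (doubledGramFin F T)))) :
        ((Fin (n + n) → AdeleRing (𝓞 F) F) × (Fin (n + n) → AdeleRing (𝓞 F) F)) ≃ₗ[AdeleRing (𝓞 F) F] ((Fin (n + n) → AdeleRing (𝓞 F) F) × (Fin (n + n) → AdeleRing (𝓞 F) F))) (0, y)).1 = 0 := by
  set D := spReindex finSumFinEquiv (Matrix.fromBlocks T 0 0 (-T)) (doublingDelta T hT) with hD
  set R := reindexW (AdeleRing (𝓞 F) F) (finSumFinEquiv : Fin n ⊕ Fin n ≃ Fin (n + n)) with hR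
  -- `D⁻¹ (0, y) = R (δ⁻¹ (0, y ∘ e))`, a re-enumerated diagonal vector
  set u₀ : (Fin n ⊕ Fin n → AdeleRing (𝓞 F) F) × (Fin n ⊕ Fin n → AdeleRing (𝓞 F) F) :=
    ((doublingDelta T hT : symplecticGroup (polar (Matrix.toLinearMap₂' (AdeleRing (𝓞 F) F) (Matrix.fromBlocks T 0 0 (-T))))) :
      ((Fin n ⊕ Fin n → AdeleRing (𝓞 F) F) × (Fin n ⊕ Fin n → AdeleRing (𝓞 F) F)) ≃ₗ[AdeleRing (𝓞 F) F] ((Fin n ⊕ Fin n → AdeleRing (𝓞 F) F) × (Fin n ⊕ Fin n → AdeleRing (𝓞 F) F))).symm (R.symm (0, y)) with hu₀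
  have hu₀d : Weil1964.IsDiag u₀ := by
    rw [hu₀, hR, reindexW_symm_apply]
    change Weil1964.IsDiag (((doublingDelta T hT : symplecticGroup (polar (Matrix.toLinearMap₂' (AdeleRing (𝓞 F) F) (Matrix.fromBlocks T 0 0 (-T))))) : ((Fin n ⊕ Fin n → AdeleRing (𝓞 F) F) × (Fin n ⊕ Fin n → AdeleRing (𝓞 F) F)) ≃ₗ[AdeleRing (𝓞 F) F] ((Fin n ⊕ Fin n → AdeleRing (𝓞 F) F) × (Fin n ⊕ Fin n → AdeleRing (𝓞 F) F))).symm (0, y ∘ finSumFinEquiv))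
    rw [doublingDelta_symm_apply_zero]
    exact isDiag_diag _ _
  have hstep : ((D * X * D⁻¹ : symplecticGroup (polar (Weil1964.adelicForm F (Fin (n + n)) (doubledGramFin F T)))) : ((Fin (n + n) → AdeleRing (𝓞 F) F) × (Fin (n + n) → AdeleRing (𝓞 F) F)) ≃ₗ[AdeleRing (𝓞 F) F] ((Fin (n + n) → AdeleRing (𝓞 F) F) × (Fin (n + n) → AdeleRing (𝓞 F) F))) (0, y) =
      ((D : symplecticGroup (polar (Weil1964.adelicForm F (Fin (n + n)) (doubledGramFin F T)))) : ((Fin (n + n) → AdeleRing (𝓞 F) F) × (Fin (n + n) → AdeleRing (𝓞 F) F)) ≃ₗ[AdeleRing (𝓞 F) F] ((Fin (n + n) → AdeleRing (𝓞 F) F) × (Fin (n + n) → AdeleRing (𝓞 F) F))) ((X : ((Fin (n + n) → AdeleRing (𝓞 F) F) × (Fin (n + n) → AdeleRing (𝓞 F) F)) ≃ₗ[AdeleRing (𝓞 F) F] ((Fin (n + n) → AdeleRing (𝓞 F) F) × (Fin (n + n) → AdeleRing (𝓞 F) F))) (R u₀)) := rfl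
  rw [hstep]
  -- `X (R u₀) = R u₁` with `u₁` diagonal
  set u₁ := R.symm ((X : ((Fin (n + n) → AdeleRing (𝓞 F) F) × (Fin (n + n) → AdeleRing (𝓞 F) F)) ≃ₗ[AdeleRing (𝓞 F) F] ((Fin (n + n) → AdeleRing (𝓞 F) F) × (Fin (n + n) → AdeleRing (𝓞 F) F))) (R u₀)) with hu₁
  have hu₁d : Weil1964.IsDiag u₁ := hX u₀ hu₀d
  have hXu : (X : ((Fin (n + n) → AdeleRing (𝓞 F) F) × (Fin (n + n) → AdeleRing (𝓞 F) F)) ≃ₗ[AdeleRing (𝓞 F) F] ((Fin (n + n) → AdeleRing (𝓞 F) F) × (Fin (n + n) → AdeleRing (𝓞 F) F))) (R u₀) = R u₁ := by rw [hu₁, LinearEquiv.apply_symm_apply]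
  rw [hXu]
  have hDapp : ((D : symplecticGroup (polar (Weil1964.adelicForm F (Fin (n + n)) (doubledGramFin F T)))) : ((Fin (n + n) → AdeleRing (𝓞 F) F) × (Fin (n + n) → AdeleRing (𝓞 F) F)) ≃ₗ[AdeleRing (𝓞 F) F] ((Fin (n + n) → AdeleRing (𝓞 F) F) × (Fin (n + n) → AdeleRing (𝓞 F) F))) (R u₁) =
      R (((doublingDelta T hT : symplecticGroup (polar (Matrix.toLinearMap₂' (AdeleRing (𝓞 F) F) (Matrix.fromBlocks T 0 0 (-T))))) : ((Fin n ⊕ Fin n → AdeleRing (𝓞 F) F) × (Fin n ⊕ Fin n → AdeleRing (𝓞 F) F)) ≃ₗ[AdeleRing (𝓞 F) F] ((Fin n ⊕ Fin n → AdeleRing (𝓞 F) F) × (Fin n ⊕ Fin n → AdeleRing (𝓞 F) F))) (R.symm (R u₁))) := rfl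
  rw [hDapp, LinearEquiv.symm_apply_apply, hu₁d.eq, doublingDelta_apply_diag, hR, reindexW_apply]
  rfl

/-- **`δ · X · δ⁻¹ ∈ P_𝕐(𝔸)` when `X` and `X⁻¹` stabilise the (re-enumerated) diagonal `W^Δ`** — the `Fin (n + n)`-frame, vector-level form
of ★ `conj_doublingDelta_mem_siegelParabolicPi`. [cite: Li1992, p. 181] -/
theorem conj_doublingDelta_mem_siegelParabolicPi_of_isDiag
    (X : symplecticGroup (polar (Weil1964.adelicForm F (Fin (n + n)) (doubledGramFin F T))))
    (hX : ∀ u : (Fin n ⊕ Fin n → AdeleRing (𝓞 F) F) × (Fin n ⊕ Fin n → AdeleRing (𝓞 F) F), Weil1964.IsDiag u →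
      Weil1964.IsDiag ((reindexW (AdeleRing (𝓞 F) F) finSumFinEquiv).symm
        ((X : ((Fin (n + n) → AdeleRing (𝓞 F) F) × (Fin (n + n) → AdeleRing (𝓞 F) F)) ≃ₗ[AdeleRing (𝓞 F) F] ((Fin (n + n) → AdeleRing (𝓞 F) F) × (Fin (n + n) → AdeleRing (𝓞 F) F))) (reindexW (AdeleRing (𝓞 F) F) finSumFinEquiv u))))
    (hX' : ∀ u : (Fin n ⊕ Fin n → AdeleRing (𝓞 F) F) × (Fin n ⊕ Fin n → AdeleRing (𝓞 F) F), Weil1964.IsDiag u →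
      Weil1964.IsDiag ((reindexW (AdeleRing (𝓞 F) F) finSumFinEquiv).symm
        ((X : ((Fin (n + n) → AdeleRing (𝓞 F) F) × (Fin (n + n) → AdeleRing (𝓞 F) F)) ≃ₗ[AdeleRing (𝓞 F) F] ((Fin (n + n) → AdeleRing (𝓞 F) F) × (Fin (n + n) → AdeleRing (𝓞 F) F))).symm (reindexW (AdeleRing (𝓞 F) F) finSumFinEquiv u)))) :
    spReindex finSumFinEquiv (Matrix.fromBlocks T 0 0 (-T)) (doublingDelta T hT) * X *
        (spReindex finSumFinEquiv (Matrix.fromBlocks T 0 0 (-T)) (doublingDelta T hT))⁻¹ ∈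
      siegelParabolicPi (doubledGramFin F T) := by
  refine ⟨fun y => conj_doublingDelta_apply_zero_fst_of_isDiag F T hT X hX y, fun y => ?_⟩
  have h : ((spReindex finSumFinEquiv (Matrix.fromBlocks T 0 0 (-T)) (doublingDelta T hT) * X *
        (spReindex finSumFinEquiv (Matrix.fromBlocks T 0 0 (-T)) (doublingDelta T hT))⁻¹ :
          symplecticGroup (polar (Weil1964.adelicForm F (Fin (n + n)) (doubledGramFin F T)))) : ((Fin (n + n) → AdeleRing (𝓞 F) F) × (Fin (n + n) → AdeleRing (𝓞 F) F)) ≃ₗ[AdeleRing (𝓞 F) F] ((Fin (n + n) → AdeleRing (𝓞 F) F) × (Fin (n + n) → AdeleRing (𝓞 F) F))).symm (0, y) =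
      ((spReindex finSumFinEquiv (Matrix.fromBlocks T 0 0 (-T)) (doublingDelta T hT) * X⁻¹ *
        (spReindex finSumFinEquiv (Matrix.fromBlocks T 0 0 (-T)) (doublingDelta T hT))⁻¹ :
          symplecticGroup (polar (Weil1964.adelicForm F (Fin (n + n)) (doubledGramFin F T)))) : ((Fin (n + n) → AdeleRing (𝓞 F) F) × (Fin (n + n) → AdeleRing (𝓞 F) F)) ≃ₗ[AdeleRing (𝓞 F) F] ((Fin (n + n) → AdeleRing (𝓞 F) F) × (Fin (n + n) → AdeleRing (𝓞 F) F))) (0, y) := by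
    rw [show spReindex finSumFinEquiv (Matrix.fromBlocks T 0 0 (-T)) (doublingDelta T hT) * X⁻¹ *
        (spReindex finSumFinEquiv (Matrix.fromBlocks T 0 0 (-T)) (doublingDelta T hT))⁻¹ =
        (spReindex finSumFinEquiv (Matrix.fromBlocks T 0 0 (-T)) (doublingDelta T hT) * X *
          (spReindex finSumFinEquiv (Matrix.fromBlocks T 0 0 (-T)) (doublingDelta T hT))⁻¹)⁻¹ by group]
    rfl
  rw [h]
  exact conj_doublingDelta_apply_zero_fst_of_isDiag F T hT X⁻¹ hX' y

end Parabolic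

/-! ## §3 The doubled `W`-member at a rational Siegel point stabilises the re-enumerated diagonal -/

section Doubled

variable (F E : Type) [Field F] [NumberField F] [Field E] [NumberField E] [Algebra F E] [Algebra.IsQuadraticExtension F E]
  (c : E ≃ₐ[F] E) {δ : E} (hcδ : c δ = -δ) (hδ : δ ≠ 0) {d : F} (hd : δ * δ = algebraMap F E d)
  (N : ℕ) {n : ℕ} (e : Fin N × Fin 1 ≃ Fin n)
  {TV : Matrix (Fin N) (Fin N) F} {TW2 : Matrix (Fin (1 + 1)) (Fin (1 + 1)) F} (hV : TV.IsSymm) (hW2 : TW2.IsSymm)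

/-- **the doubled `W`-member at a rational SIEGEL point stabilises the diagonal Lagrangian `V ⊗ W^Δ`** (in the `Fin (n + n)` frame of the
doubled enumeration `eD = E₁.trans finSumFinEquiv`): for a rational `w` of the rank-two `W`-space with `w₀₀ + w₀₁ = w₁₀ + w₁₁`, the automorphism
`ι(1 ⊗ w) = toSp eD (adelicInr (toAdelic w))` carries every re-enumerated diagonal vector to a re-enumerated diagonal vector.
[cite: GelbartPiatetskishapiroRallis1987, Part A §2 p. 9; HarrisKudlaSweet1996, §1 (1.11)] -/
theorem isDiag_toSp_doubled_rationalInr (w : rational F E c (1 + 1) (TW2.map (algebraMap F E)))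
    (hw : ((w : GL (Fin (1 + 1)) E) : Matrix (Fin (1 + 1)) (Fin (1 + 1)) E) 0 0 +
        ((w : GL (Fin (1 + 1)) E) : Matrix (Fin (1 + 1)) (Fin (1 + 1)) E) 0 1 =
      ((w : GL (Fin (1 + 1)) E) : Matrix (Fin (1 + 1)) (Fin (1 + 1)) E) 1 0 +
        ((w : GL (Fin (1 + 1)) E) : Matrix (Fin (1 + 1)) (Fin (1 + 1)) E) 1 1)
    (u : ((Fin n ⊕ Fin n → AdeleRing (𝓞 F) F) × (Fin n ⊕ Fin n → AdeleRing (𝓞 F) F))) (hu : Weil1964.IsDiag u) :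
    Weil1964.IsDiag ((reindexW (AdeleRing (𝓞 F) F) finSumFinEquiv).symm
      (((GelbartRogawski1991.UnitaryDualPair.toSp F E c N (1 + 1) ((((Equiv.prodCongr (Equiv.refl (Fin N)) finSumFinEquiv.symm).trans (Equiv.prodSumDistrib (Fin N) (Fin 1) (Fin 1))).trans
      (Equiv.sumCongr e e)).trans finSumFinEquiv)
          (TV.map (algebraMap F E)) (TW2.map (algebraMap F E)) hcδ hδ hd hV hW2 rfl rfl
          (adelicInr F E c N (1 + 1) (TV.map (algebraMap F E)) (TW2.map (algebraMap F E)) (toAdelic F E c (1 + 1) (TW2.map (algebraMap F E)) w)) :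
            symplecticGroup (polar (Weil1964.adelicForm F (Fin (n + n))
              (GelbartRogawski1991.UnitaryDualPair.adelicGram F ((((Equiv.prodCongr (Equiv.refl (Fin N)) finSumFinEquiv.symm).trans (Equiv.prodSumDistrib (Fin N) (Fin 1) (Fin 1))).trans
      (Equiv.sumCongr e e)).trans finSumFinEquiv) TV TW2)))) :
        ((Fin (n + n) → AdeleRing (𝓞 F) F) × (Fin (n + n) → AdeleRing (𝓞 F) F)) ≃ₗ[AdeleRing (𝓞 F) F] ((Fin (n + n) → AdeleRing (𝓞 F) F) × (Fin (n + n) → AdeleRing (𝓞 F) F)))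
        (reindexW (AdeleRing (𝓞 F) F) finSumFinEquiv u))) := by
  set E₁ : Fin N × Fin (1 + 1) ≃ Fin n ⊕ Fin n := (((Equiv.prodCongr (Equiv.refl (Fin N)) finSumFinEquiv.symm).trans (Equiv.prodSumDistrib (Fin N) (Fin 1) (Fin 1))).trans
      (Equiv.sumCongr e e)) with hE₁
  have hE0 : ∀ i, E₁ (i, 0) = Sum.inl (e (i, 0)) := doubledFrame_apply_zero e
  have hE1 : ∀ i, E₁ (i, 1) = Sum.inr (e (i, 0)) := doubledFrame_apply_one e
  -- the pulled-back vector `(u.1 ∘ E₁, u.2 ∘ E₁)` has equal `W`-coordinates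
  have hv : (∀ i, ((reindexW (AdeleRing (𝓞 F) F) E₁).symm u).1 (i, 0) = ((reindexW (AdeleRing (𝓞 F) F) E₁).symm u).1 (i, 1)) ∧
      ∀ i, ((reindexW (AdeleRing (𝓞 F) F) E₁).symm u).2 (i, 0) = ((reindexW (AdeleRing (𝓞 F) F) E₁).symm u).2 (i, 1) := by
    rw [reindexW_symm_apply]
    exact (isDiag_iff_of_frame e hE0 hE1 u).1 hu
  have hP := adelicPairToSymplectic_rationalInr_diag F E c hcδ hδ hd N hV hW2 (JV := TV.map (algebraMap F E))
    (JW := TW2.map (algebraMap F E)) rfl rfl w hw _ hv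
  rw [GelbartRogawski1991.UnitaryDualPair.toSp_apply, adelicInr_toAdelic]
  -- unfold the re-enumeration `eD = E₁.trans finSumFinEquiv` on both sides
  rw [coe_spReindex_apply]
  change Weil1964.IsDiag ((reindexW (AdeleRing (𝓞 F) F) finSumFinEquiv).symm
    (reindexW (AdeleRing (𝓞 F) F) finSumFinEquiv (reindexW (AdeleRing (𝓞 F) F) E₁
      (((adelicPairToSymplectic F E c N (1 + 1) hcδ hδ hd hV hW2 rfl rfl
        (rationalPairToAdelic F E c N (1 + 1) (TV.map (algebraMap F E)) (TW2.map (algebraMap F E))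
          (rationalInr F E c N (1 + 1) (TV.map (algebraMap F E)) (TW2.map (algebraMap F E)) w)) :
            symplecticGroup (polar (Matrix.toLinearMap₂' (AdeleRing (𝓞 F) F)
              ((TV.map (algebraMap F (AdeleRing (𝓞 F) F))) ⊗ₖ (TW2.map (algebraMap F (AdeleRing (𝓞 F) F))))))) :
          ((Fin N × Fin (1 + 1) → AdeleRing (𝓞 F) F) × (Fin N × Fin (1 + 1) → AdeleRing (𝓞 F) F)) ≃ₗ[AdeleRing (𝓞 F) F]
            ((Fin N × Fin (1 + 1) → AdeleRing (𝓞 F) F) × (Fin N × Fin (1 + 1) → AdeleRing (𝓞 F) F)))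
        ((reindexW (AdeleRing (𝓞 F) F) E₁).symm ((reindexW (AdeleRing (𝓞 F) F) finSumFinEquiv).symm
          (reindexW (AdeleRing (𝓞 F) F) finSumFinEquiv u)))))))
  rw [LinearEquiv.symm_apply_apply, LinearEquiv.symm_apply_apply, isDiag_iff_of_frame e hE0 hE1, reindexW_apply]
  refine ⟨fun i => ?_, fun i => ?_⟩
  · simp only [Function.comp_apply, Equiv.symm_apply_apply]
    have h := hP.1 i
    exact h
  · simp only [Function.comp_apply, Equiv.symm_apply_apply]
    exact hP.2 i

end Doubled

end UnitaryGroup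

end Literature.NumberTheory.Automorphic
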